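import Summits.BirchSwinnertonDyer.BirchSwinnertonDyer.Theorems.AdditiveBranchIMCGordTwoRankOneWanAnyRoadDefs
import Summits.BirchSwinnertonDyer.BirchSwinnertonDyer.Theses.AdditiveBranchIMC
import HarnessLib

/-!
# Crux 19358 `GordTwoRankOne` (and its r0 twin 19357) — brick E3′ VOCABULARY SKETCH (pen bsd-addord-plan g45, e19)
# «a potentially-multiplicative additive twist-type prime `ℓ₀ ≠ p` as the K-RAMIFIED Wan prime»

v5 (2026-08-31T00:30Z): + R5 CONSUMER SHAPES `RamifiedTwistClass` / `FHThmBValueShape` / `FHThmBSimpleZeroShape` (typer guidance for wi-99841; sign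
hypothesis explicit, discharged by the LEAD's `TwistRootNumberTwisted*` theorems p796562/p796897/p796997) + glue `tameRoadFieldTwisted_of_ramifiedTwistClass`.
v4 (2026-08-30T23:25Z): + `TwistedWanRoadRowFirstCutA` (case A of the first cut: `W₁` non-split at `ℓ₀`, class = residue class, `ν(λ₀) = +1`)
with `twistedWanRoadRowFirstCut_of_caseA`, for the LEAD's v38 cut «case A first» (19358 v26 mirrors whatever v38 registers).
v3 (2026-08-30T20:00Z, after director ruling (661)(A) «E3′ STAGED» and the memo ERRATUM v6 583e9725031fffc1): + `TwistedWanRoadRowFirstCut`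
(the first E3′ cut «ℓ₀ odd ∧ p ∤ ℓ₀ + 1», on which the EXISTING `f_E`-keyed frames serve: the tree's naive `rankinSelbergValueHecke f_E χ 1`
is the λ₀-DEPLETED value `(1 + ℓ₀⁻¹) ×` the primitive one of `(g = f_{W₁}, ν·χ)`, a unit discrepancy iff `p ∤ ℓ₀ + 1`); NOTE: the
character `ν = χ_{ℓ₀*} ∘ N_{K/ℚ}` used throughout the memo is the GENUS character of `K` — everywhere UNRAMIFIED, conductor 1 (a ring-class
character), `ν(λ₀) = χ_{d_K/ℓ₀*}(ℓ₀)`; the docstring of `BaseChangeNonsplit` below says exactly this («`χ_{ℓ*} ∘ N_{K_λ/ℚ_ℓ}` is unramified»).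
v2 (2026-08-30T19:25Z): + `FieldOneTwistedR0` (the r0 twin of the field supply); `PartnerTwisted` is the no-additive-2 form (rows additive at 2 of
twist type need the `_two` partner sibling with `ℓ₀ ∈ d`); print status of R3 (Hsieh Thm 1/2 for branch characters, arXiv:1112.1580 p.3–4, p.11 (R1))
and R4 (LZZ 2018 «only 𝔭 split», arXiv:1511.08172 p.3) CHECKED on held texts — memo §4 PRINT-STATUS CHECK.

PREDICATES AND STATEMENTS ONLY — nothing asserted, no `sorry`, no registered line touched. This file types, in the tree's
currency, the objects of the decision memo `HOME/planner/g2_3f_enlarge/e19/README.md` §2/§4 so that the director / the next LEAD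
can price brick E3′ against exact signatures:

* `TwistedWanPrime W p ℓ` — the E3′ Wan prime: `ℓ` odd, `ℓ ≠ p`, `E` additive at `ℓ`, `W₁ := E^{(ℓ*)}` MULTIPLICATIVE at `ℓ`
  (potentially multiplicative of quadratic-twist type), Skinner–Urban's clause as `p ∤ v_ℓ(j(E))` (`v_ℓ(Δ_min(W₁)) = −v_ℓ(j)`).
* `NonsplitClassAt W ℓ K` — the CLASS CLAUSE on `K`: `ℓ ∣ d_K` and, with `d_K = ℓ*·m`, `(m/ℓ) = +1` if `W₁` is non-split at `ℓ`,
  `(m/ℓ) = −1` if split (so that `E/K_λ` is NON-split multiplicative — `NonsplitOverAt`, the geometric form the chain consumes).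
* `TameRoadFieldTwisted W p ℓ K` — the E3′ road field: `K` imaginary quadratic, `d_K < −4`, the class clause at `ℓ`, every other
  prime of `N_E` split, `2` split if `2 ∤ N_E`, `p` split.
* `TwistedWanRoadRow W p` — THE E3′ SUB-ROW: `p ≥ 5`, `ρ̄` onto, every additive prime `≠ p` of quadratic-twist type (dyadic and odd
  clauses verbatim `WanAnyRoad`/`TwistRoadRow`), and an E3′ Wan prime. Pen census e19 (line currency, Cremona `N < 5·10⁵`):
  SU-strict +1 683 r1 / +1 460 r0 pairs, of which classes C ∪ E (713 r0 / 847 r1) are reachable by no other K-design.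
* the three TREE-LEMMA statements of memo §4: `BaseChangeNonsplit` (h), `EngineTwisted` (g: `w(E^{(d_K)}) = −w(E)`),
  `PartnerTwisted` (a: the semistable partner with `ℓ₀ ∣ d`, `ℓ₀ ∥ N_{V₀}`), and the FIELD-ONE supply statement `FieldOneTwisted`
  (to be proved from Friedberg–Hoffstein 1995 Thm B in its general form, reading R5 — NOT in the tree);
* `TwistedWanChainShape Facts` — the shape of the [L] chain stub, with the printed-facts conjunction (readings R2–R4 of the memo,
  not yet typed) as an opaque parameter.

References (scope statements only; the readings are the typer's): F. Castella, Z. Liu, X. Wan, Forum Math. Sigma 10 (2022) e110,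
§5.2, Thm 8.2.1; M.-L. Hsieh, Doc. Math. 19 (2014) Thm B; Y. Liu, S. Zhang, W. Zhang, Duke Math. J. 167 (2018) Thm 1.5; L. Cai,
J. Shu, Y. Tian, Algebra Number Theory 8 (2014) Thm 1.1; S. Friedberg, J. Hoffstein, Ann. of Math. 142 (1995) Thm B; D. Rohrlich,
Compositio Math. 87 (1993) Prop. 2–3; J. H. Silverman, AEC VII.5, C.14–15 (Tate curve).
-/

noncomputable section

set_option autoImplicit false
set_option linter.dupNamespace false

open scoped Classical

open NumberField IsDedekindDomain Rat.HeightOneSpectrum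
open WeierstrassCurve Literature.NumberTheory.EllipticCurves Literature.NumberTheory.EllipticCurves.ModularForms
open Literature.NumberTheory.EllipticCurves.Rank1Residual
open Summit.BirchSwinnertonDyer.Rank1Residual
open Summit.BirchSwinnertonDyer.Rank1Residual.Additive
open Summit.BirchSwinnertonDyer.BirchSwinnertonDyer.Theses.AdditiveBranchIMC
open Summit.BirchSwinnertonDyer.BirchSwinnertonDyer.Theorems
open Summit.BirchSwinnertonDyer.BirchSwinnertonDyer.Theorems.WanAnyRoad

namespace Summit.BirchSwinnertonDyer.BirchSwinnertonDyer.Cruxes.GordTwoRankOne.TwistedWanSketch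

/-- `ℓ* = (−1)^{⌊ℓ/2⌋} ℓ` (the kernel's spelling of `(−1)^{(ℓ−1)/2} ℓ` for an odd prime `ℓ`). [notation-free helper] -/
def primeStar (ℓ : ℕ) : ℤ := (-1) ^ (ℓ / 2) * ℓ

/-- THE E3′ WAN PRIME: an ODD prime `ℓ ≠ p` at which `E` (globally minimal `W`) is ADDITIVE, of quadratic-twist type AND
POTENTIALLY MULTIPLICATIVE — `W₁ := E^{(ℓ*)}` has multiplicative reduction at `ℓ` (Kodaira `I_n^*` at `ℓ`) —, with Skinner–Urban's
ramification clause `p ∤ v_ℓ(Δ_min(W₁)) = −v_ℓ(j(E))` in the model-free form `p ∤ v_ℓ(j)`. [predicate; nothing asserted] -/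
def TwistedWanPrime (W : WeierstrassCurve ℚ) [W.IsElliptic] (p ℓ : ℕ) [hℓ : Fact ℓ.Prime] : Prop :=
  ℓ ≠ p ∧ ℓ ≠ 2 ∧ W.HasAdditiveReductionAt ((primesEquiv (R := ℤ)).symm ⟨ℓ, hℓ.out⟩) ∧
    (W.quadraticTwist ((primeStar ℓ : ℤ) : ℚ)).HasMultiplicativeReductionAtPrime ℓ ∧
    ¬ (p : ℤ) ∣ padicValRat ℓ W.j

/-- THE CLASS CLAUSE at the E3′ Wan prime: `ℓ ∣ d_K` and, writing `d_K = ℓ* · m` (`m` an `ℓ`-unit), `(m/ℓ) = +1` when `W₁ = E^{(ℓ*)}` is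
NON-split multiplicative at `ℓ` and `(m/ℓ) = −1` when it is split. Over the ramified completion `K_λ = ℚ_ℓ(√d_K)` the character
`χ_{ℓ*} ∘ N_{K_λ/ℚ_ℓ}` is trivial iff `(m/ℓ) = +1`, so this is exactly the class for which `E/K_λ ≅ (W₁ ⊗ χ_{ℓ*}∘N)/K_λ` is NON-split
multiplicative (`BaseChangeNonsplit`). [predicate; nothing asserted] -/
def NonsplitClassAt (W : WeierstrassCurve ℚ) [W.IsElliptic] (ℓ : ℕ) [Fact ℓ.Prime]
    (K : Type) [Field K] [NumberField K] : Prop :=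
  (ℓ : ℤ) ∣ NumberField.discr K ∧
    legendreSym ℓ (NumberField.discr K / primeStar ℓ) =
      (if (W.quadraticTwist ((primeStar ℓ : ℤ) : ℚ)).HasSplitMultiplicativeReductionAtPrime ℓ then -1 else 1)

/-- The GEOMETRIC form consumed by the chain (`StepL` case analysis at the ramified prime; CST's `HeegnerConditionRC`; Hsieh's
Hypothesis A): at every prime `λ` of `K` above `ℓ`, `E/K` has NON-split multiplicative reduction. [predicate; nothing asserted] -/
def NonsplitOverAt (W : WeierstrassCurve ℚ) (ℓ : ℕ) (K : Type) [Field K] [NumberField K] : Prop :=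
  ∀ v : HeightOneSpectrum (𝓞 K), (ℓ : 𝓞 K) ∈ v.asIdeal →
    (W.baseChange K).HasMultiplicativeReductionAt v ∧ ¬ (W.baseChange K).HasSplitMultiplicativeReductionAt v

/-- THE E3′ ROAD FIELD: `K` imaginary quadratic with `d_K < −4`, the E3′ Wan prime `ℓ` RAMIFIED in `K` IN THE NON-SPLIT CLASS
(`NonsplitClassAt`), every other prime of `N_E` split, `2` split if `2 ∤ N_E`, `p` split — the sibling of `WanAnyRoad.TameRoadFieldAny`
with `WanPrimeAny W p q ∧ q ∣ d_K` replaced by `TwistedWanPrime W p ℓ ∧ NonsplitClassAt W ℓ K`. [predicate; nothing asserted] -/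
def TameRoadFieldTwisted (W : WeierstrassCurve ℚ) [W.IsElliptic] [W.IsGloballyMinimal] (p ℓ : ℕ) [Fact ℓ.Prime]
    (K : Type) [Field K] [NumberField K] : Prop :=
  IsImaginaryQuadratic K ∧ NumberField.discr K < -4 ∧ TwistedWanPrime W p ℓ ∧ NonsplitClassAt W ℓ K ∧
    (∀ r : ℕ, r.Prime → r ∣ W.conductorNorm ℤ → r ≠ ℓ → ((Ideal.span {(r : ℤ)}).primesOver (𝓞 K)).ncard = 2) ∧
    (¬ 2 ∣ W.conductorNorm ℤ → ((Ideal.span {(2 : ℤ)}).primesOver (𝓞 K)).ncard = 2) ∧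
    SatisfiesHeegnerHypothesis p K

/-- THE E3′ SUB-ROW: `p ≥ 5`, `ρ̄_{E,p}` onto, every additive prime `≠ p` of QUADRATIC-TWIST type (dyadic clause and odd clause
verbatim `TwistRoadRow` of the v25 skeleton / the `WanAnyRoad` kernels' `h2tt`, `htt`), and an E3′ Wan prime. Pen census e19:
+1 683 r1 / +1 460 r0 pairs (SU-strict, line currency); classes C ∪ E of e16 (847 / 713) lie here and in no other design.
[predicate; nothing asserted] -/
def TwistedWanRoadRow (W : WeierstrassCurve ℚ) [W.IsElliptic] [W.IsGloballyMinimal] (p : ℕ) [Fact p.Prime] : Prop :=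
  5 ≤ p ∧ Surj W p ∧
    (∀ r : Nat.Primes, (r : ℕ) = 2 → W.HasAdditiveReductionAt ((primesEquiv (R := ℤ)).symm r) →
      ∃ t : ℤ, (t = -1 ∨ t = 2 ∨ t = -2) ∧
        ¬ (W.quadraticTwist (t : ℚ)).HasAdditiveReductionAt ((primesEquiv (R := ℤ)).symm r)) ∧
    (∀ r : Nat.Primes, (r : ℕ) ≠ 2 → W.HasAdditiveReductionAt ((primesEquiv (R := ℤ)).symm r) →
      ¬ (W.quadraticTwist (((-1 : ℤ) ^ ((r : ℕ) / 2) * r : ℤ) : ℚ)).HasAdditiveReductionAt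
        ((primesEquiv (R := ℤ)).symm r)) ∧
    (∃ ℓ : ℕ, ∃ _ : Fact ℓ.Prime, TwistedWanPrime W p ℓ)

/-- THE FIRST E3′ CUT (memo v6 ERRATUM (2), director ruling (661)(A)(b) «case A (odd ℓ₀) first»): a twisted Wan row with an ODD
twisted Wan prime `ℓ₀` such that `p ∤ ℓ₀ + 1` — exactly the sub-row on which the λ₀-depleted (naive, `f_E`-keyed) anticyclotomic
objects differ from the primitive ones by a `p`-adic UNIT `(ℓ₀ + 1)/ℓ₀` (census: 1 428 / 1 460 r0, 1 653 / 1 683 r1 strict rows keep an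
admissible `ℓ₀`). Case A («`W₁` non-split at `ℓ₀`», so the non-split class is the residue class) is a FIELD-side refinement left to the
LEAD's cut. -/
def TwistedWanRoadRowFirstCut (W : WeierstrassCurve ℚ) [W.IsElliptic] [W.IsGloballyMinimal] (p : ℕ) [Fact p.Prime] : Prop :=
  TwistedWanRoadRow W p ∧ ∃ ℓ : ℕ, ∃ _ : Fact ℓ.Prime, TwistedWanPrime W p ℓ ∧ ℓ ≠ 2 ∧ ¬ p ∣ ℓ + 1

/-- CASE A OF THE FIRST CUT (director ruling (661)(A)(b) «case A (odd ℓ₀) first»; memo §2): additionally `W₁ = E^{(ℓ₀*)}` is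
NON-SPLIT multiplicative at `ℓ₀`, so that the non-split class `NonsplitClassAt W ℓ₀ K` is the RESIDUE class `(m/ℓ₀) = +1`
(`d_K = ℓ₀*·m`) and `ν(λ₀) = +1` — the sub-case in which the genus character is locally trivial at `λ₀` and every display of the
chain is literally the E2 display with `q := ℓ₀`; case B (`W₁` split at `ℓ₀`, class `(m/ℓ₀) = −1`, `ν(λ₀) = −1`) is the same
mathematics with one sign carried. Census split A : B among strict rows is roughly even (pen e19 TSV column `W1_splittype_at_l0`). -/
def TwistedWanRoadRowFirstCutA (W : WeierstrassCurve ℚ) [W.IsElliptic] [W.IsGloballyMinimal] (p : ℕ) [Fact p.Prime] : Prop :=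
  TwistedWanRoadRow W p ∧ ∃ ℓ : ℕ, ∃ _ : Fact ℓ.Prime, TwistedWanPrime W p ℓ ∧ ℓ ≠ 2 ∧ ¬ p ∣ ℓ + 1 ∧
    ¬ (W.quadraticTwist ((primeStar ℓ : ℤ) : ℚ)).HasSplitMultiplicativeReductionAtPrime ℓ

theorem twistedWanRoadRowFirstCut_of_caseA {W : WeierstrassCurve ℚ} [W.IsElliptic] [W.IsGloballyMinimal] {p : ℕ} [Fact p.Prime]
    (h : TwistedWanRoadRowFirstCutA W p) : TwistedWanRoadRowFirstCut W p := by
  obtain ⟨hrow, ℓ, hℓ, htw, h2, hp, -⟩ := h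
  exact ⟨hrow, ℓ, hℓ, htw, h2, hp⟩

theorem twistedWanRoadRow_of_firstCut {W : WeierstrassCurve ℚ} [W.IsElliptic] [W.IsGloballyMinimal] {p : ℕ} [Fact p.Prime]
    (h : TwistedWanRoadRowFirstCut W p) : TwistedWanRoadRow W p := h.1

/-! ### The three tree lemmas of memo §4, as STATEMENTS (a prover proves them in `Theorems/`; sizes S/M) -/

/-- TREE LEMMA (h) [M] — BASE CHANGE TO THE PRESCRIBED RAMIFIED CLASS IS NON-SPLIT MULTIPLICATIVE: for an E3′ Wan prime `ℓ` and
`K` imaginary quadratic in the class `NonsplitClassAt W ℓ K`, `E/K_λ` is non-split multiplicative at the prime `λ` above `ℓ`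
(Tate curve: `E ≅ W₁ ⊗ χ_{ℓ*}` over `ℚ_ℓ` with `W₁` multiplicative, and `χ_{ℓ*} ∘ N_{K_λ/ℚ_ℓ}` is unramified, trivial iff `(m/ℓ) = +1`).
[statement; nothing asserted] -/
def BaseChangeNonsplit : Prop :=
  ∀ (W : WeierstrassCurve ℚ) [W.IsElliptic] (p ℓ : ℕ) [Fact ℓ.Prime] (K : Type) [Field K] [NumberField K],
    IsImaginaryQuadratic K → TwistedWanPrime W p ℓ → NonsplitClassAt W ℓ K → NonsplitOverAt W ℓ K

/-- TREE LEMMA (g) [S/M] — THE E3′ ROOT-NUMBER ENGINE: for modular `E` whose additive primes `≠ p` are of quadratic-twist type and an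
E3′ road field `K`, `w(E^{(d_K)}) = −w(E)` (equivalently `w(E/K) = −1`: local signs `+1` at the split places, `+1` at the NON-split
multiplicative `λ`, `+1` at the ramified good primes of `K` after the product formula for `χ_{d_K}(−1)`, `−1` at `∞`). Route in the
tree: `E^{(d_K)} = W₁^{(m)}` with `(m, N_{W₁}) = 1` and the coprime engines. [statement; nothing asserted] -/
def EngineTwisted : Prop :=
  ∀ (W : WeierstrassCurve ℚ) [W.IsElliptic] [W.IsGloballyMinimal], exists_isNewformOf →
    ∀ (p ℓ : ℕ) [Fact ℓ.Prime] (K : Type) [Field K] [NumberField K], TameRoadFieldTwisted W p ℓ K →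
      (W.quadraticTwist (NumberField.discr K : ℚ)).rootNumber = -W.rootNumber

/-- TREE LEMMA (a) [S/M] — THE SEMISTABLE PARTNER WITH THE E3′ WAN PRIME INSIDE THE TWIST: the sibling of
`TwistTypePartnerData.exists_semistable_partner_data_odd` (p752196 / LEAD g13) WITHOUT the multiplicative prime `q` and its output
clause «`ℓ ∣ d → ℓ ≠ q`»; instead the designated E3′ Wan prime `ℓ₀` divides `d` and divides `N_{V₀}` EXACTLY ONCE (`V₀ = E^{(p*·d)}` is
multiplicative at `ℓ₀`). Same construction `d := ∏ ℓ*` over the additive primes `ℓ ≠ p`. [statement; nothing asserted] -/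
def PartnerTwisted : Prop :=
  ∀ (W : WeierstrassCurve ℚ) [W.IsElliptic] [W.IsGloballyMinimal] (p : ℕ) [Fact p.Prime], 5 ≤ p → N10.CellGordTwo W p → Surj W p →
    (∀ v : HeightOneSpectrum ℤ, W.HasAdditiveReductionAt v → 2 < ringChar (ℤ ⧸ v.asIdeal)) →
    (∀ r : Nat.Primes, (r : ℕ) ≠ 2 → W.HasAdditiveReductionAt ((primesEquiv (R := ℤ)).symm r) →
      ¬ (W.quadraticTwist (((-1 : ℤ) ^ ((r : ℕ) / 2) * r : ℤ) : ℚ)).HasAdditiveReductionAt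
        ((primesEquiv (R := ℤ)).symm r)) →
    ∀ (ℓ₀ : ℕ) [Fact ℓ₀.Prime], TwistedWanPrime W p ℓ₀ →
    ∃ (V : WeierstrassCurve ℚ) (_ : V.IsElliptic) (_ : V.IsGloballyMinimal) (C : VariableChange ℚ) (d : ℤ),
      C • W.quadraticTwist ((-1 : ℚ) ^ (p / 2) * p * d) = V ∧ d % 4 = 1 ∧ ¬ (p : ℤ) ∣ d ∧ (ℓ₀ : ℤ) ∣ d ∧
      (∀ ℓ : ℕ, ℓ.Prime → (ℓ : ℤ) ∣ d → ℓ ∣ W.conductorNorm ℤ) ∧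
      Squarefree (V.conductorNorm ℤ) ∧ ¬ p ∣ V.conductorNorm ℤ ∧ Surj V p ∧ ℓ₀ ∣ V.conductorNorm ℤ ∧
      (2 ∣ W.conductorNorm ℤ → 2 ∣ V.conductorNorm ℤ)

/-- THE E3′ RANK-ONE FIELD SUPPLY (statement; its proof needs Friedberg–Hoffstein 1995 Thm B in the GENERAL form — a prescribed
ramified quadratic local component at `ℓ`, every other bad prime and `p` split —, reading R5 of the memo, NOT in the tree; the typed
`friedbergHoffstein_exists_twist_ne_zero_ramifiedAt` hard-wires «`W` multiplicative non-split at `q`» and does not serve): for modular `E`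
with `w(E) = −1`, an E3′ Wan prime `ℓ`, an odd prime `p ≠ ℓ` and a bound `B`, an E3′ road field `K` with `|d_K| > B` and `L(E^{(d_K)}, 1) ≠ 0`.
[statement; nothing asserted] -/
def FieldOneTwisted : Prop :=
  ∀ (W : WeierstrassCurve ℚ) [W.IsElliptic] [W.IsGloballyMinimal], exists_isNewformOf →
    (∀ r : Nat.Primes, (r : ℕ) = 2 → W.HasAdditiveReductionAt ((primesEquiv (R := ℤ)).symm r) →
      ∃ t : ℤ, (t = -1 ∨ t = 2 ∨ t = -2) ∧
        ¬ (W.quadraticTwist (t : ℚ)).HasAdditiveReductionAt ((primesEquiv (R := ℤ)).symm r)) →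
    (∀ r : Nat.Primes, (r : ℕ) ≠ 2 → W.HasAdditiveReductionAt ((primesEquiv (R := ℤ)).symm r) →
      ¬ (W.quadraticTwist (((-1 : ℤ) ^ ((r : ℕ) / 2) * r : ℤ) : ℚ)).HasAdditiveReductionAt
        ((primesEquiv (R := ℤ)).symm r)) →
    W.rootNumber = -1 →
    ∀ (p ℓ : ℕ) [Fact ℓ.Prime], p.Prime → p ≠ 2 → TwistedWanPrime W p ℓ → ∀ B : ℕ,
      ∃ (K : Type) (_ : Field K) (_ : NumberField K),
        TameRoadFieldTwisted W p ℓ K ∧ B < (NumberField.discr K).natAbs ∧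
          (W.quadraticTwist (NumberField.discr K : ℚ)).entireLFunction 1 ≠ 0

/-- FIELD ONE, RANK-ZERO TWIN (supplies the r0 field for crux 19357's E3′ sub-row; sibling of
`friedbergHoffstein_exists_twist_simpleZero_ramifiedAt_splitAt` with the prescribed local component at the K-ramified prime `ℓ₀` =
the NON-SPLIT CLASS of `NonsplitClassAt`): for `w(E) = +1` and a twisted Wan prime `ℓ₀` there are tame road fields of twisted type
with `|d_K|` unbounded and `L(E^{(d_K)}, 1) = 0`, `L′(E^{(d_K)}, 1) ≠ 0` (sign `w(E^{(d_K)}) = −1` by `EngineTwisted`). Print input: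
Friedberg–Hoffstein 1995 Thm. B, second alternative, GENERAL form (prescribed quadratic local components at a finite set of places) —
the tree's `-- TODO(general form)` of `NonvanishingTwistsPrescribedRamificationSimpleZero.lean`; text not held (acq-00930 cite-only). -/
def FieldOneTwistedR0 : Prop :=
  ∀ (W : WeierstrassCurve ℚ) [W.IsElliptic] [W.IsGloballyMinimal], exists_isNewformOf →
    (∀ r : Nat.Primes, (r : ℕ) = 2 → W.HasAdditiveReductionAt ((primesEquiv (R := ℤ)).symm r) →
      ∃ t : ℤ, (t = -1 ∨ t = 2 ∨ t = -2) ∧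
        ¬ (W.quadraticTwist (t : ℚ)).HasAdditiveReductionAt ((primesEquiv (R := ℤ)).symm r)) →
    (∀ r : Nat.Primes, (r : ℕ) ≠ 2 → W.HasAdditiveReductionAt ((primesEquiv (R := ℤ)).symm r) →
      ¬ (W.quadraticTwist (((-1 : ℤ) ^ ((r : ℕ) / 2) * r : ℤ) : ℚ)).HasAdditiveReductionAt
        ((primesEquiv (R := ℤ)).symm r)) →
    W.rootNumber = 1 →
    ∀ (p ℓ : ℕ) [Fact ℓ.Prime], p.Prime → p ≠ 2 → TwistedWanPrime W p ℓ → ∀ B : ℕ,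
      ∃ (K : Type) (_ : Field K) (_ : NumberField K),
        TameRoadFieldTwisted W p ℓ K ∧ B < (NumberField.discr K).natAbs ∧
          (W.quadraticTwist (NumberField.discr K : ℚ)).entireLFunction 1 = 0 ∧
          deriv (W.quadraticTwist (NumberField.discr K : ℚ)).entireLFunction 1 ≠ 0

/-- THE SHAPE OF THE E3′ [L] CHAIN STUB for crux 19358 (the printed-facts conjunction `Facts` = readings R2 CLW-sibling, R3 Hsieh
ν-branch, R4 LZZ ν-branch of the memo + the existing ten facts; opaque here because R2–R4 are not typed): field supply → facts → on the
E3′ sub-row of cell (G-ord, `e = 2`) in analytic rank one, `MissingLowerBoundAt`. [statement shape; nothing asserted] -/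
def TwistedWanChainShape (Facts : Prop) : Prop :=
  FieldOneTwisted → Facts →
    ∀ (W : WeierstrassCurve ℚ) [W.IsElliptic] [W.IsGloballyMinimal] (p : ℕ) [Fact p.Prime],
      W.analyticRank = 1 → N10.CellGordTwo W p → TwistedWanRoadRow W p →
        Literature.NumberTheory.EllipticCurves.Rank1Residual.Typed.MissingLowerBoundAt W p

/-! ### Sanity: the E3′ sub-row and the E2 / twist sub-rows are stated over the same clauses -/

/-- An E3′ row satisfies the two twist-type clauses of `TwistRoadRow`-shape by definition (projection). [folklore] -/
theorem twistClauses_of_twistedWanRoadRow (W : WeierstrassCurve ℚ) [W.IsElliptic] [W.IsGloballyMinimal] (p : ℕ) [Fact p.Prime]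
    (h : TwistedWanRoadRow W p) :
    5 ≤ p ∧ Surj W p ∧
      (∀ r : Nat.Primes, (r : ℕ) ≠ 2 → W.HasAdditiveReductionAt ((primesEquiv (R := ℤ)).symm r) →
        ¬ (W.quadraticTwist (((-1 : ℤ) ^ ((r : ℕ) / 2) * r : ℤ) : ℚ)).HasAdditiveReductionAt
          ((primesEquiv (R := ℤ)).symm r)) :=
  ⟨h.1, h.2.1, h.2.2.2.1⟩

/-- The road field of an E3′ row carries the E3′ Wan prime and its class clause (projection). [folklore] -/
theorem twistedWanPrime_of_tameRoadFieldTwisted (W : WeierstrassCurve ℚ) [W.IsElliptic] [W.IsGloballyMinimal] (p ℓ : ℕ)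
    [Fact ℓ.Prime] (K : Type) [Field K] [NumberField K] (h : TameRoadFieldTwisted W p ℓ K) :
    TwistedWanPrime W p ℓ ∧ NonsplitClassAt W ℓ K ∧ (ℓ : ℤ) ∣ NumberField.discr K :=
  ⟨h.2.2.1, h.2.2.2.1, h.2.2.2.1.1⟩

/-! ### R5 CONSUMER SHAPES (v5; typer guidance for WANTED cite item wi-99841 — NOT Literature facts here)

What the [M] stubs `stub_fieldOneTwisted` (19358 v26) / `stub_fieldOneTwistedR0` (19357 v37) need FROM PRINT, in the curve-and-field
currency of the tree's two typed Friedberg–Hoffstein special cases (`friedbergHoffstein_exists_twist_ne_zero_ramifiedAt`,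
`friedbergHoffstein_exists_twist_simpleZero_ramifiedAt_splitAt`), with the SIGN HYPOTHESIS LEFT EXPLICIT (a hypothesis on the class,
discharged problem-side by the LEAD's tree theorems `TwistRootNumberTwisted.rootNumber_quadraticTwist_discr_eq_neg_of_twistedRoadField_caseA`
(p796997) etc.) so that the named fact is a faithful special case of [FriedbergHoffstein1995, Thm. B] and says nothing about reduction types:
`S₀ = {∞, 2, p, ℓ₀} ∪ {r ∣ N_W}`; the local quadratic components are fixed by the clauses of `RamifiedTwistClass` (sign character at `∞`,
trivial = split at `p`, at `2 ∤ N_W` and at every `r ∣ N_W`, `r ≠ ℓ₀`; at `ℓ₀` the RAMIFIED character `ℚ_{ℓ₀}(√(ℓ₀*·u))`, `(u/ℓ₀) = s`),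
so the class IS an FH class `Ψ(S₀; ξ)` (infinite), on which the root number of `W^{(d_K)}` is CONSTANT (all places where `π_W` or `χ_{d_K}`
interact are in `S₀`). First alternative (value, for r_an(E) = 1: sign of the partner `+1`) and second alternative (simple zero, for
r_an(E) = 0: sign `−1`; summarised in [DiaconuTian2005, §2.2 p. 1357] and Zbl 0847.11026). The typer chooses names / file; these decls only
fix the SHAPE the [M] proofs will consume (`FieldOneTwisted` ⇐ value shape at `s := NonsplitClassAt`'s sign + `EngineTwisted` (field
currency) + `discr K < −4` from `B ≥ 4`; `FieldOneTwistedR0` ⇐ simple-zero shape likewise). -/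

/-- The FH class of brick E3′ in field currency: `K` imaginary quadratic, `ℓ₀ ∣ d_K` with `d_K/ℓ₀*` in the residue class of sign `s`
modulo `ℓ₀`, every bad prime `r ≠ ℓ₀` of `W` split, `2` split if `2 ∤ N_W`, and the Heegner/`p`-split clause the chains carry. -/
def RamifiedTwistClass (W : WeierstrassCurve ℚ) [W.IsElliptic] (p ℓ₀ : ℕ) [Fact ℓ₀.Prime] (s : ℤ)
    (K : Type) [Field K] [NumberField K] : Prop :=
  IsImaginaryQuadratic K ∧ (ℓ₀ : ℤ) ∣ NumberField.discr K ∧ legendreSym ℓ₀ (NumberField.discr K / primeStar ℓ₀) = s ∧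
    (∀ r : ℕ, r.Prime → r ∣ W.conductorNorm ℤ → r ≠ ℓ₀ → ((Ideal.span {(r : ℤ)}).primesOver (𝓞 K)).ncard = 2) ∧
    (¬ 2 ∣ W.conductorNorm ℤ → ((Ideal.span {(2 : ℤ)}).primesOver (𝓞 K)).ncard = 2) ∧
    SatisfiesHeegnerHypothesis p K

/-- R5, FIRST ALTERNATIVE (central VALUE): if every member of the class has root number `+1`, the class contains members of
arbitrarily large `|d_K|` with `L(W^{(d_K)}, 1) ≠ 0`. [shape of FriedbergHoffstein1995 Thm. B (1) on `Ψ(S₀; ξ)`; nothing asserted] -/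
def FHThmBValueShape : Prop :=
  ∀ (W : WeierstrassCurve ℚ) [W.IsElliptic] (p ℓ₀ : ℕ) [Fact ℓ₀.Prime] (s : ℤ), p.Prime → ℓ₀ ≠ 2 → ℓ₀ ≠ p → (s = 1 ∨ s = -1) →
    (∀ (K : Type) [Field K] [NumberField K], RamifiedTwistClass W p ℓ₀ s K →
      (W.quadraticTwist (NumberField.discr K : ℚ)).rootNumber = 1) →
    ∀ B : ℕ, ∃ (K : Type) (_ : Field K) (_ : NumberField K),
      RamifiedTwistClass W p ℓ₀ s K ∧ B < (NumberField.discr K).natAbs ∧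
        (W.quadraticTwist (NumberField.discr K : ℚ)).entireLFunction 1 ≠ 0

/-- R5, SECOND ALTERNATIVE (SIMPLE ZERO): if every member of the class has root number `−1`, the class contains members of
arbitrarily large `|d_K|` with `L(W^{(d_K)}, 1) = 0 ≠ L'(W^{(d_K)}, 1)`. [shape of FriedbergHoffstein1995 Thm. B (2); nothing asserted] -/
def FHThmBSimpleZeroShape : Prop :=
  ∀ (W : WeierstrassCurve ℚ) [W.IsElliptic] (p ℓ₀ : ℕ) [Fact ℓ₀.Prime] (s : ℤ), p.Prime → ℓ₀ ≠ 2 → ℓ₀ ≠ p → (s = 1 ∨ s = -1) →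
    (∀ (K : Type) [Field K] [NumberField K], RamifiedTwistClass W p ℓ₀ s K →
      (W.quadraticTwist (NumberField.discr K : ℚ)).rootNumber = -1) →
    ∀ B : ℕ, ∃ (K : Type) (_ : Field K) (_ : NumberField K),
      RamifiedTwistClass W p ℓ₀ s K ∧ B < (NumberField.discr K).natAbs ∧
        (W.quadraticTwist (NumberField.discr K : ℚ)).entireLFunction 1 = 0 ∧
        deriv (W.quadraticTwist (NumberField.discr K : ℚ)).entireLFunction 1 ≠ 0

/-- Glue check: in the class with `s` = the sign of `NonsplitClassAt`, a member of `RamifiedTwistClass` at a twisted Wan prime with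
`4 ≤ B < |d_K|` is an E3′ road field. -/
theorem tameRoadFieldTwisted_of_ramifiedTwistClass {W : WeierstrassCurve ℚ} [W.IsElliptic] [W.IsGloballyMinimal] {p ℓ₀ : ℕ}
    [Fact ℓ₀.Prime] {K : Type} [Field K] [NumberField K] (htw : TwistedWanPrime W p ℓ₀)
    (hK : RamifiedTwistClass W p ℓ₀
      (if (W.quadraticTwist ((primeStar ℓ₀ : ℤ) : ℚ)).HasSplitMultiplicativeReductionAtPrime ℓ₀ then -1 else 1) K)
    (hB : 4 < (NumberField.discr K).natAbs) : TameRoadFieldTwisted W p ℓ₀ K := by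
  obtain ⟨hiq, hdvd, hleg, hsplit, h2, hH⟩ := hK
  have hneg : NumberField.discr K < 0 := hiq.discr_neg
  refine ⟨hiq, ?_, htw, ⟨hdvd, hleg⟩, hsplit, h2, hH⟩
  have : (4 : ℤ) < (NumberField.discr K).natAbs := by exact_mod_cast hB
  omega

end Summit.BirchSwinnertonDyer.BirchSwinnertonDyer.Cruxes.GordTwoRankOne.TwistedWanSketch

end
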